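import Summits.ResolutionOfSingularities.ResolutionOfSingularities.Theorems.FrobeniusLadderFInjectiveMacaulayficationP2d5CSpecimen
import Literature.AlgebraicGeometry.Resolution.AffineBlowupAlgebra
import Mathlib.RingTheory.Localization.Away.Basic
import HarnessLib

/-!
# (O-1′-Z) The Rees chart `D(z̄)` of `Bl_τ(P2d5C)` carries NO point over the vertex: `𝔪_v · A₀[τ/z̄] = (1)`
# (crux `FInjectiveMacaulayfication` stmt-ResolutionOfSingularities-15315, chain w45a; res-L1-w45a-plan-1 g19 RULING R19.15 «(O-1′) → stub-1: D(z̄) empty over v»;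
# seat res-L1-w45a-stub-1 g11; pattern = res-L1-w45a-stub-3's `TauFloorF5ZChart` p634730: `1 = −(x̄²·(x̄²/z̄) + Σ ȳ·(ȳ/z̄)²) ∈ 𝔪_v·B_z` from `f/z̄²`)

[OURS · L1 W4.5a] Support file (`--supports stmt-ResolutionOfSingularities-15315 --as helper`); replaces the role of NO printed item; NOT a statement of
any manuscript; def-free; UNCONDITIONAL; characteristic-free. AI-written (AI review is weaker than expert review).

`A₀ = k[X0..X5]/(f)`, `f = X5² + X0⁴X5 + X1³ + X2³ + X3³ + X4³`, `τ = Ideal.span {x̄², ȳ, ū, t̄, s̄, z̄}`, `v` the vertex. In `A₀[1/z̄]` with `i = 1/z̄`: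
`f·i² = 0` reads `1 + x̄²·(x̄²i) + ȳ·(ȳi)² + ū·(ūi)² + t̄·(t̄i)² + s̄·(s̄i)² = 0` (`ident_z`), and `x̄²i, ȳi, ūi, t̄i, s̄i ∈ A₀[τ/z̄]`; so `1 ∈ 𝔪_v · A₀[τ/z̄]`:
★ `map_vertex_eq_top`. Consequence (used by the row assembly via `LocalBlowupInputFromCharts.not_comap_eq_of_map_eq_top`): no prime of the chart `D(z̄)`
contracts to `v`. [cite: GortzWedhorn2020, (13.19) p. 415]
-/

-- single-problem summit: the doubled namespace component is forced
set_option linter.dupNamespace false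

noncomputable section

namespace Summit.ResolutionOfSingularities.ResolutionOfSingularities.Theorems.FInjectiveMacaulayfication.TauFloorP2d5CZChart

open MvPolynomial IsLocalization Literature.AlgebraicGeometry.Resolution
open Summit.ResolutionOfSingularities.ResolutionOfSingularities.Theorems.FInjectiveMacaulayfication

variable (k : Type) [Field k]

/-- `1 + (x²·(x²·i) + y·(y·i)² + u·(u·i)² + t·(t·i)² + s·(s·i)²) = 0` when `f(x,y,u,t,s,z) = 0` and `z·i = 1`. [ring identity] -/
theorem ident_z {L : Type} [CommRing L] (x y u t s z i : L) (hF : z ^ 2 + x ^ 4 * z + y ^ 3 + u ^ 3 + t ^ 3 + s ^ 3 = 0) (hzi : z * i = 1) :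
    1 + (x ^ 2 * (x ^ 2 * i) + y * (y * i) ^ 2 + u * (u * i) ^ 2 + t * (t * i) ^ 2 + s * (s * i) ^ 2) = 0 := by
  linear_combination i ^ 2 * hF + (-(1 + z * i + x ^ 4 * i)) * hzi

set_option synthInstance.maxHeartbeats 200000 in
set_option maxHeartbeats 1600000 in
-- instance search on `Localization.Away` over the quotient ring is slow (as in `TauFloorF5ZChart`)
/-- ★ **`𝔪_v · A₀[τ/z̄] = (1)`**: the Rees chart `D(z̄)` of `Bl_τ(P2d5C)` has no prime over the vertex. [cite: GortzWedhorn2020, (13.19) p. 415] -/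
theorem map_vertex_eq_top (f : MvPolynomial (Fin 6) k) (hf : f = X 5 ^ 2 + X 0 ^ 4 * X 5 + X 1 ^ 3 + X 2 ^ 3 + X 3 ^ 3 + X 4 ^ 3)
    (v : AlgebraicGeometry.Spec (.of (MvPolynomial (Fin 6) k ⧸ Ideal.span {f})))
    (hv : v.asIdeal = Ideal.span (Set.range fun j : Fin 6 => Ideal.Quotient.mk (Ideal.span {f}) (X j))) :
    v.asIdeal.map (algebraMap (MvPolynomial (Fin 6) k ⧸ Ideal.span {f}) (blowupAlgebra (Ideal.span {Ideal.Quotient.mk (Ideal.span {f}) (X 0) ^ 2, Ideal.Quotient.mk (Ideal.span {f}) (X 1),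
          Ideal.Quotient.mk (Ideal.span {f}) (X 2), Ideal.Quotient.mk (Ideal.span {f}) (X 3), Ideal.Quotient.mk (Ideal.span {f}) (X 4), Ideal.Quotient.mk (Ideal.span {f}) (X 5)} :
            Ideal (MvPolynomial (Fin 6) k ⧸ Ideal.span {f})) (Ideal.Quotient.mk (Ideal.span {f}) (X 5)))) = ⊤ := by
  classical
  let mkA : MvPolynomial (Fin 6) k →+* MvPolynomial (Fin 6) k ⧸ Ideal.span {f} := Ideal.Quotient.mk (Ideal.span {f})
  let τ : Ideal (MvPolynomial (Fin 6) k ⧸ Ideal.span {f}) := Ideal.span {mkA (X 0) ^ 2, mkA (X 1), mkA (X 2), mkA (X 3), mkA (X 4), mkA (X 5)}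
  let L := Localization.Away (mkA (X 5))
  let B : Subalgebra (MvPolynomial (Fin 6) k ⧸ Ideal.span {f}) L := blowupAlgebra τ (mkA (X 5))
  let ι : (MvPolynomial (Fin 6) k ⧸ Ideal.span {f}) →+* L := algebraMap _ _
  let inv : L := Away.invSelf (mkA (X 5))
  have hzi : ι (mkA (X 5)) * inv = 1 := Away.mul_invSelf (S := L) (mkA (X 5))
  have hF : ι (mkA (X 5)) ^ 2 + ι (mkA (X 0)) ^ 4 * ι (mkA (X 5)) + ι (mkA (X 1)) ^ 3 + ι (mkA (X 2)) ^ 3 + ι (mkA (X 3)) ^ 3 + ι (mkA (X 4)) ^ 3 = 0 := by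
    have h0 : mkA (X 5 ^ 2 + X 0 ^ 4 * X 5 + X 1 ^ 3 + X 2 ^ 3 + X 3 ^ 3 + X 4 ^ 3) = 0 := by
      rw [← hf]; exact Ideal.Quotient.eq_zero_iff_mem.mpr (Ideal.mem_span_singleton_self f)
    have h1 := congrArg ι h0
    rw [map_zero] at h1
    simpa only [map_add, map_mul, map_pow] using h1
  -- the five elements of `B`
  have m0 : ι (mkA (X 0)) ^ 2 * inv ∈ B := by rw [← map_pow ι]; exact div_mem_blowupAlgebra τ (mkA (X 5)) (Ideal.subset_span (by simp))
  have m1 : ι (mkA (X 1)) * inv ∈ B := div_mem_blowupAlgebra τ (mkA (X 5)) (Ideal.subset_span (by simp))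
  have m2 : ι (mkA (X 2)) * inv ∈ B := div_mem_blowupAlgebra τ (mkA (X 5)) (Ideal.subset_span (by simp))
  have m3 : ι (mkA (X 3)) * inv ∈ B := div_mem_blowupAlgebra τ (mkA (X 5)) (Ideal.subset_span (by simp))
  have m4 : ι (mkA (X 4)) * inv ∈ B := div_mem_blowupAlgebra τ (mkA (X 5)) (Ideal.subset_span (by simp))
  -- the identity in `B`
  have key : (1 : B) = -(algebraMap _ B (mkA (X 0)) ^ 2 * ⟨_, m0⟩ + algebraMap _ B (mkA (X 1)) * ⟨_, m1⟩ ^ 2 + algebraMap _ B (mkA (X 2)) * ⟨_, m2⟩ ^ 2 +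
      algebraMap _ B (mkA (X 3)) * ⟨_, m3⟩ ^ 2 + algebraMap _ B (mkA (X 4)) * ⟨_, m4⟩ ^ 2) := by
    rw [eq_neg_iff_add_eq_zero]
    apply Subtype.ext
    simp only [Subalgebra.coe_add, Subalgebra.coe_mul, Subalgebra.coe_pow, Subalgebra.coe_one, Subalgebra.coe_zero, Subalgebra.coe_algebraMap]
    exact ident_z _ _ _ _ _ _ inv hF hzi
  -- every `x̄ⱼ` lies in `𝔪_v`
  have hmem : ∀ j : Fin 6, mkA (X j) ∈ v.asIdeal := fun j => by rw [hv]; exact Ideal.subset_span ⟨j, rfl⟩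
  rw [Ideal.eq_top_iff_one, key]
  refine neg_mem (Ideal.add_mem _ (Ideal.add_mem _ (Ideal.add_mem _ (Ideal.add_mem _ ?_ ?_) ?_) ?_) ?_)
  · exact Ideal.mul_mem_right _ _ (Ideal.pow_mem_of_mem _ (Ideal.mem_map_of_mem _ (hmem 0)) 2 two_pos)
  · exact Ideal.mul_mem_right _ _ (Ideal.mem_map_of_mem _ (hmem 1))
  · exact Ideal.mul_mem_right _ _ (Ideal.mem_map_of_mem _ (hmem 2))
  · exact Ideal.mul_mem_right _ _ (Ideal.mem_map_of_mem _ (hmem 3))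
  · exact Ideal.mul_mem_right _ _ (Ideal.mem_map_of_mem _ (hmem 4))

end Summit.ResolutionOfSingularities.ResolutionOfSingularities.Theorems.FInjectiveMacaulayfication.TauFloorP2d5CZChart

end
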